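import Summits.QuantumFields.YangMills.Theorems.BalabanUVNodesN07Eq48AtRecord
import HarnessLib

/-!
# N07 — THE LOG-DEFECT BRIDGE OF THE NONLINEAR CONSTRAINT (20) AT THE RECORD: `Q(U₀)A′ + C_k(A′) = (1∕i)·log( Ū^k_h(exp(iη_kA′)·U₀) · (Ū^kU₀)⋆ )` by the
# DEFINITION of 3e′'s `COfRecord`, hence «`Ū^k_h(exp(iηA′)U₀) = V` ⟺ `Q A′ + C(A′) = B(V)`» (⟸ on the log-disc); `Q` read on the functions IS 3b's `qCplxOp` (T-Q);
# consequence for LOCATED-g28-2: at def-Y's (47)-free chart, «average of the chart image `= V`» forces `C_k(𝒜(V) + 𝔄(V)) = 0`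

Cell `pub-ymgap`, width seat `pub-ymgap-dag-n07-w3` (g28), INTENT-3 ∕ CLAIM-3.  `--kind proof --supports stmt-QuantumFields-27238 --as helper`; count-neutral.  Follows this seat's
✓`…N07Eq48AtRecord` ((48) at the record) and the memo `LOCATED-CHART-T47.g28.md` (evidence #9 on ⟨27238⟩; RR-2 g31 READ 9: letters CONFIRMED, number owed).  [15] = [Balaban1985Variational].

WHAT (kernel, sorry-free, standard axioms; any `N`, any background `U₀`, level `k`; `Q A′` := `readFun (phiRec N) _ (wBRec F K k) (QOfRecord F N k U₀) (JetSup.equiv … A′)`, the reading of (45)∕(109)).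
* §1 ★★ `readFun_QOfRecord_jet_eq_qCplxOp` (T-Q, the identification 3e′'s HONEST LABEL (1) ∕ RR-2's T-C1′ companion displays): `Q A′ = qCplxOp k U₀ (evLit A′)` — `QOfRecord` IS
  `bondFieldOut ∘ qCplxOp ∘ bondFieldIn` (3b) and the carrier maps cancel (`funEquiv`, `phiRec`, `bondToLit`); pure unfolding.
* §2 ★★ `readFun_Q_add_C_apply` — **THE BRIDGE IDENTITY**: `(Q A′)(c) + C(A′)(c) = (1∕i)·mlog( Ū^k_h(expOver U₀ (η•evLit A′))(c) · (Ū^kU₀)(c)⋆ )` for every coarse bond `c` — the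
  body of ✓`COfRecord` (`(1∕i)log(…) − qCplxOp …`) plus §1; `B(V)(c) = (1∕i)·mlog(V(c)·(Ū^kU₀)(c)⋆)` is ✓`BOfRecord_apply`.
* §3 ★★ `Q_add_C_eq_B_of_iterMh_eq` (⟹, no smallness): `Ū^k_h(expOver U₀ (η•evLit A′)) = ↑V ⟹ Q A′ + C(A′) = B(V)`;
  ★★ `iterMh_eq_of_Q_add_C_eq_B` (⟸, on the log-disc): `Q A′ + C(A′) = B(V)` and both relative units `Ū_h(…)(c)(Ū^kU₀)(c)⋆`, `V(c)(Ū^kU₀)(c)⋆` within `‖· − 1‖ < 1`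
  ⟹ `Ū^k_h(expOver U₀ (η•evLit A′)) = ↑V` (lit ✓`MatrixLog.exp_mlog` + unitarity of `Ū^kU₀`).
* §4 ★★★ `COfRecord_sol_add_frakA_eq_zero_of_iterMh_eq` — **LOCATED-g28-2, KERNEL-VISIBLE HALF**: at the scheme of record (EL hypotheses: a regime of the data, `‖J‖ ≤ j`,
  `‖𝔄(V)‖ < a𝔄`, `FrakGSliceTok`), if the holomorphic average of def-Y's (47)-FREE chart field `expOver U₀ (η•evLit (𝒜(V) + 𝔄(V)))` equals `↑V` — which is what the KNIT tokens
  (rng) ∧ (star_mem) assert for `S.chartCfg V` once `suOfMat` is transparent and the guard identifies `Ū_h` with `↑Ū` — then `C_k(𝒜(V) + 𝔄(V)) = 0`: the LINEAR constraint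
  ✓`bgSchemeOfRecord_Q_chart` (`Q(𝒜 + 𝔄) = B`) against §3.  Print's field `T47(𝒜 + 𝔄)` instead satisfies `Q + C^{𝔰𝔩} = B` (✓`readFun_Q_T47_sol_add_frakA`), so
  ★★★ `iterMh_T47_eq_of_logDisc` (§5): on the log-disc and for traceless `T47(A′)` (`C^{𝔰𝔩} = C` there), `Ū^k_h(expOver U₀ (η•evLit (T47(𝒜(V) + 𝔄(V))))) = ↑V` — the average clause the
  CURED chart needs, modulo the displayed log-disc rows and the guard∕`SU`-valuedness that turn `Ū_h` into `↑Ū` (not typed here).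

HONEST LABELS.  Definitional unfoldings + one use of `exp ∘ mlog = id` on the disc; every analytic input (regimes, `FrakGSliceTok`, radii, log-disc rows, tracelessness of `T47 A′`) DISPLAYED;
the NUMBER of LOCATED-g28-2 (`C_k ∘ (𝒜 + 𝔄) ≢ 0` near `1`) is NOT supplied — §4 only makes the tension kernel-visible; def-Y's chart letters untouched (their custody); nothing of Bałaban's
estimates re-derived; K0ᴬ ⟨27238⟩ NOT closed; N07 NOT discharged; R4 is the conditional finite-𝕋⁴ rung `BalabanLadder.UV` only; finite torus, fixed `ε` — nothing continuum ∕ OS ∕ Clay.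
**The Yang–Mills mass gap is NOT proved by any of this.**  No `sorry`, no `def`, no `instance ∕ notation`; standard axioms.
-/

set_option autoImplicit false

noncomputable section

open scoped Matrix Matrix.Norms.L2Operator InnerProductSpace

namespace Summit.QuantumFields.YangMills.Theorems.N07ConstraintLogBridge

open Literature.MathematicalPhysics.QuantumFieldTheory.Balaban1983to89
open Literature.MathematicalPhysics.QuantumFieldTheory.Balaban1983to89.T4Continuum (T4Family)
open Literature.MathematicalPhysics.QuantumFieldTheory.Balaban1983to89.Node00
open NormedSpace (exp)
open MatrixLog (mlog exp_mlog)
open B15AveragingHolomorphic (iterMh)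
open B11Eq103H1Complex (SiteL2K BondL2K readFun readFun_apply funEquiv funEquiv_apply funEquiv_symm_apply QFun)
open B11Eq111FrakG (nabla115)
open B11Eq115Space (NegSize NegSup levWeight JetSup)
open B11Eq174Chart (Regime)
open B11Eq90V0GroupComposed (T47)
open Summit.QuantumFields.YangMills.Theorems.N07Eq48AtRecord (readFun_Q_T47_sol_add_frakA readFun_eq_funEquiv_QFun)

section Record

variable (F : T4Family) (N : ℕ) [NeZero N] (K : ℕ) (k : ℕ) (Ω : ℕ → Set (Site (F.P K) 0)) (U₀ : GaugeField (F.P K) 0 (SU N))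
  [Fact (0 < (F.L : ℝ))] [Fact (0 < (F.P K).eta k)] [Fact (0 < c0Rec F K k)] [Fact (∀ c, 0 < wBRec F K k c)]
  (levB : PBond (F.P K) k → ℕ)

/-! ## §1  T-Q: `Q` read on the functions IS `qCplxOp ∘ evLit` -/

omit [NeZero N] [Fact (0 < (F.L : ℝ))] [Fact (0 < (F.P K).eta k)] [Fact (0 < c0Rec F K k)] [Fact (∀ c, 0 < wBRec F K k c)] in
/-- ★★ **T-Q**: the record's `Q(U₀)` read on the functions along the jet presentation IS 3b's `qCplxOp k U₀` on the (19)-presentation `evLit A′` — the carrier maps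
`bondFieldIn ∕ bondFieldOut ∕ funEquiv (phiRec N)` cancel (pure unfolding of ✓`QOfRecord := bondFieldOut ∘ qCplxOp ∘ bondFieldIn`).
[cite: Balaban1985BackgroundPropagators, (3.13)–(3.16) p.393; Balaban1985Variational, (44) p.285, (19) p.281] -/
theorem readFun_QOfRecord_jet_eq_qCplxOp (A : Space115Lit F N K k Ω U₀) :
    readFun (phiRec N) _ (wBRec F K k) (QOfRecord F N k U₀) (JetSup.equiv _ _ (nabla115 ((F.P K).eta k) (unitsOfRecord F N U₀)) A) =
      qCplxOp k U₀ (evLit F N K k Ω U₀ A) := by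
  funext c
  rw [readFun_apply, funEquiv_apply, QOfRecord_apply, LinearEquiv.apply_symm_apply]
  rfl

/-! ## §2  The bridge identity `Q A′ + C(A′) = (1∕i)·log(relative average of the chart field)` -/

omit [Fact (0 < (F.L : ℝ))] [Fact (0 < (F.P K).eta k)] [Fact (0 < c0Rec F K k)] [Fact (∀ c, 0 < wBRec F K k c)] in
/-- ★★ **THE LOG-DEFECT BRIDGE** (the body of 3e′'s `COfRecord`, (44) «`Q(ηA) = ηQA + C(ηA)`» read at the record with `L^kη_k = 1`):
`(Q A′)(c) + C(A′)(c) = (1∕i)·mlog( Ū^k_h(expOver U₀ (η_k•evLit A′))(c) · (Ū^kU₀)(c)⋆ )`. [cite: Balaban1985Variational, (44) p.285, (20) p.281; Balaban1985BackgroundPropagators, (3.13) p.393] -/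
theorem readFun_Q_add_C_apply (A : Space115Lit F N K k Ω U₀) (c : PBond (F.P K) k) :
    readFun (phiRec N) _ (wBRec F K k) (QOfRecord F N k U₀) (JetSup.equiv _ _ (nabla115 ((F.P K).eta k) (unitsOfRecord F N U₀)) A) c +
        NegSup.equiv _ _ (COfRecord F N K k Ω U₀ levB A) c =
      (Complex.I⁻¹ : ℂ) • mlog (iterMh k (expOver U₀ ((((F.P K).eta k : ℝ) : ℂ) • evLit F N K k Ω U₀ A)) c
          * star (Averaging.iter (avOfRecord F N K) k U₀ c : Matrix (Fin N) (Fin N) ℂ)) := by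
  rw [COfRecord_apply, readFun_QOfRecord_jet_eq_qCplxOp]
  abel

omit [Fact (0 < (F.L : ℝ))] [Fact (0 < (F.P K).eta k)] [Fact (0 < c0Rec F K k)] [Fact (∀ c, 0 < wBRec F K k c)] in
/-- The bridge as an identity of functions. [cite: Balaban1985Variational, (44) p.285, (20) p.281] -/
theorem readFun_Q_add_C (A : Space115Lit F N K k Ω U₀) :
    readFun (phiRec N) _ (wBRec F K k) (QOfRecord F N k U₀) (JetSup.equiv _ _ (nabla115 ((F.P K).eta k) (unitsOfRecord F N U₀)) A) +
        NegSup.equiv _ _ (COfRecord F N K k Ω U₀ levB A) =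
      fun c => (Complex.I⁻¹ : ℂ) • mlog (iterMh k (expOver U₀ ((((F.P K).eta k : ℝ) : ℂ) • evLit F N K k Ω U₀ A)) c
          * star (Averaging.iter (avOfRecord F N K) k U₀ c : Matrix (Fin N) (Fin N) ℂ)) :=
  funext fun c => readFun_Q_add_C_apply F N K k Ω U₀ levB A c

/-! ## §3  «`Ū_h(chart field) = V` ⟺ `Q A′ + C(A′) = B(V)`» (⟸ on the log-disc) -/

omit [Fact (0 < (F.L : ℝ))] [Fact (0 < (F.P K).eta k)] [Fact (0 < c0Rec F K k)] [Fact (∀ c, 0 < wBRec F K k c)] in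
/-- ★★ **(⟹) NONLINEAR AVERAGE `= V` GIVES `Q A′ + C(A′) = B(V)`** (no smallness needed: both sides are the same logarithm).
[cite: Balaban1985Variational, (20) p.281, (44) p.285] -/
theorem Q_add_C_eq_B_of_iterMh_eq (A : Space115Lit F N K k Ω U₀) {V : GaugeField (F.P K) k (SU N)}
    (h : iterMh k (expOver U₀ ((((F.P K).eta k : ℝ) : ℂ) • evLit F N K k Ω U₀ A)) = coeField V) :
    readFun (phiRec N) _ (wBRec F K k) (QOfRecord F N k U₀) (JetSup.equiv _ _ (nabla115 ((F.P K).eta k) (unitsOfRecord F N U₀)) A) +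
        NegSup.equiv _ _ (COfRecord F N K k Ω U₀ levB A) =
      NegSup.equiv _ _ (BOfRecord F N K k U₀ levB V) := by
  funext c
  rw [Pi.add_apply, readFun_Q_add_C_apply, h, coeField_apply, BOfRecord_apply]

omit [Fact (0 < (F.L : ℝ))] [Fact (0 < (F.P K).eta k)] [Fact (0 < c0Rec F K k)] [Fact (∀ c, 0 < wBRec F K k c)] in
/-- ★★ **(⟸) ON THE LOG-DISC, `Q A′ + C(A′) = B(V)` GIVES THE NONLINEAR AVERAGE `= V`**: both relative units `Ū_h(…)(c)·(Ū^kU₀)(c)⋆` and `V(c)·(Ū^kU₀)(c)⋆` within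
`‖· − 1‖ < 1` (where `exp ∘ mlog = id`, lit ✓`MatrixLog.exp_mlog`) and `Ū^kU₀` unitary ⟹ `Ū^k_h(expOver U₀ (η•evLit A′)) = ↑V`.
[cite: Balaban1985Variational, (20) p.281, (44) p.285; Balaban1985Averaging, (21) p.21] -/
theorem iterMh_eq_of_Q_add_C_eq_B (A : Space115Lit F N K k Ω U₀) {V : GaugeField (F.P K) k (SU N)}
    (h : readFun (phiRec N) _ (wBRec F K k) (QOfRecord F N k U₀) (JetSup.equiv _ _ (nabla115 ((F.P K).eta k) (unitsOfRecord F N U₀)) A) +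
        NegSup.equiv _ _ (COfRecord F N K k Ω U₀ levB A) =
      NegSup.equiv _ _ (BOfRecord F N K k U₀ levB V))
    (hdiscA : ∀ c, ‖iterMh k (expOver U₀ ((((F.P K).eta k : ℝ) : ℂ) • evLit F N K k Ω U₀ A)) c
        * star (Averaging.iter (avOfRecord F N K) k U₀ c : Matrix (Fin N) (Fin N) ℂ) - 1‖ < 1)
    (hdiscV : ∀ c, ‖(V c : Matrix (Fin N) (Fin N) ℂ) * star (Averaging.iter (avOfRecord F N K) k U₀ c : Matrix (Fin N) (Fin N) ℂ) - 1‖ < 1) :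
    iterMh k (expOver U₀ ((((F.P K).eta k : ℝ) : ℂ) • evLit F N K k Ω U₀ A)) = coeField V := by
  funext c
  have hc := congrFun h c
  rw [Pi.add_apply, readFun_Q_add_C_apply, BOfRecord_apply] at hc
  -- cancel the scalar `i⁻¹` and the logarithm on the disc
  have hI : (Complex.I⁻¹ : ℂ) ≠ 0 := inv_ne_zero Complex.I_ne_zero
  have hlog := smul_right_injective (Matrix (Fin N) (Fin N) ℂ) hI hc
  have hexp := congrArg exp hlog
  rw [exp_mlog (hdiscA c), exp_mlog (hdiscV c)] at hexp
  -- cancel the unitary `(Ū^kU₀)(c)⋆` on the right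
  set W : Matrix (Fin N) (Fin N) ℂ := (Averaging.iter (avOfRecord F N K) k U₀ c : Matrix (Fin N) (Fin N) ℂ) with hW
  have hWW : star W * W = 1 := Matrix.mem_unitaryGroup_iff'.mp (Matrix.mem_specialUnitaryGroup_iff.mp (Averaging.iter (avOfRecord F N K) k U₀ c).2).1
  have e := congrArg (fun M : Matrix (Fin N) (Fin N) ℂ => M * W) hexp
  simp only [mul_assoc, hWW, mul_one] at e
  rw [coeField_apply]
  exact e

/-! ## §4  LOCATED-g28-2, kernel-visible half: at def-Y's (47)-free chart «average `= V`» forces `C(𝒜 + 𝔄) = 0` -/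

section Scheme

variable (a : ℝ)
  (hposb : ∀ x, x ≠ 0 → 0 < RCLike.re ⟪x, laplaceAOfRecord F N k U₀ (QOfRecord F N k U₀) (QflatOfRecord F N k) a x⟫_ℂ)
  (hQ : Function.Surjective (QOfRecord F N k U₀))
  (Gp : SiteL2K ℂ (F.P K).d (fun _ => (F.P K).sitesPerDir 0) (c0Rec F K k) (WRec N) →ₗ[ℂ]
    SiteL2K ℂ (F.P K).d (fun _ => (F.P K).sitesPerDir 0) (c0Rec F K k) (WRec N))
  (Δ2 : BondL2K ℂ (F.P K).d (fun _ => (F.P K).sitesPerDir 0) (c0Rec F K k) (WRec N) →ₗ[ℂ]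
    BondL2K ℂ (F.P K).d (fun _ => (F.P K).sitesPerDir 0) (c0Rec F K k) (WRec N))
  (hposπ : ∀ x, x ≠ 0 → 0 < RCLike.re ⟪x, laplaceAOfRecordAt F N k U₀ (hessOpOfRecord128 F N k U₀ Gp (QflatOfRecord F N k) Δ2)
    (QOfRecord F N k U₀) (QflatOfRecord F N k) a x⟫_ℂ)

/-- The LINEAR constraint of the scheme's fixed point, read on the functions: `Q(𝒜(V) + 𝔄(V)) = B(V)` (✓`bgSchemeOfRecord_Q_chart` + ✓`Q_H1OfRecordAtBg128`).
[cite: Balaban1985Variational, (20) p.281, (103) p.293, (109) p.294] -/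
theorem readFun_Q_sol_add_frakA (dom : Set (GaugeField (F.P K) k (SU N))) {εC B₀ C₄ a₃ j a𝔄 ε₄ : ℝ}
    (R : Regime (frakGOfRecordAtBg128 F N K k Ω U₀ Gp Δ2 a hposπ hQ) (0 : Space115Lit F N K k Ω U₀ →L[ℂ] Space115Lit F N K k Ω U₀)
      (WOfRecordAt F N K k Ω U₀ levB a hposb hQ εC Gp) B₀ 0 C₄ a₃ j a𝔄 ε₄)
    (hJ : ‖JOfRecordAtBg F N K k Ω U₀‖ ≤ j) {V : GaugeField (F.P K) k (SU N)} (h𝔄 : ‖frakAOfRecordAtBg128 F N K k Ω U₀ levB Gp Δ2 a hposπ hQ V‖ < a𝔄)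
    (h𝔊 : FrakGSliceTok F N K k Ω U₀ Gp Δ2 a hposπ hQ) :
    readFun (phiRec N) _ (wBRec F K k) (QOfRecord F N k U₀)
        (JetSup.equiv _ _ (nabla115 ((F.P K).eta k) (unitsOfRecord F N U₀))
          ((bgSchemeOfRecord F N K k Ω U₀ dom levB Gp Δ2 a hposπ hposb hQ εC B₀ C₄ a₃ j a𝔄 ε₄).sol V + frakAOfRecordAtBg128 F N K k Ω U₀ levB Gp Δ2 a hposπ hQ V)) =
      NegSup.equiv _ _ (BOfRecord F N K k U₀ levB V) := by
  rw [readFun_eq_funEquiv_QFun, bgSchemeOfRecord_Q_chart F N K k Ω U₀ levB Gp Δ2 a hposπ hposb hQ dom R hJ h𝔄 h𝔊, ← readFun_eq_funEquiv_QFun,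
    frakAOfRecordAtBg128_eq]
  exact Q_H1OfRecordAtBg128 F N K k Ω U₀ levB Gp Δ2 a hposπ hQ (BOfRecord F N K k U₀ levB V)

/-- ★★★ **LOCATED-g28-2, KERNEL-VISIBLE HALF**: if the holomorphic `k`-fold average of def-Y's (47)-FREE chart field at the fixed point, `expOver U₀ (η•evLit (𝒜(V) + 𝔄(V)))`,
equals `↑V` (what (rng) ∧ (star_mem) say of `S.chartCfg V`, once `suOfMat` is transparent and the guard identifies `Ū_h` with `↑Ū`), then the record's nonlinear constraint letter VANISHES
there: `C_k(𝒜(V) + 𝔄(V)) = 0` — §3 (`Q + C = B`) against the scheme's LINEAR constraint (`Q = B`).  Print asks this of NO configuration: its field is `T47(𝒜 + 𝔄)` ((47), (48)).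
[cite: Balaban1985Variational, (20) p.281, (44) p.285, (47)–(48) p.285, (109) p.294, Prop. 6 (116) p.295] -/
theorem COfRecord_sol_add_frakA_eq_zero_of_iterMh_eq (dom : Set (GaugeField (F.P K) k (SU N))) {εC B₀ C₄ a₃ j a𝔄 ε₄ : ℝ}
    (R : Regime (frakGOfRecordAtBg128 F N K k Ω U₀ Gp Δ2 a hposπ hQ) (0 : Space115Lit F N K k Ω U₀ →L[ℂ] Space115Lit F N K k Ω U₀)
      (WOfRecordAt F N K k Ω U₀ levB a hposb hQ εC Gp) B₀ 0 C₄ a₃ j a𝔄 ε₄)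
    (hJ : ‖JOfRecordAtBg F N K k Ω U₀‖ ≤ j) {V : GaugeField (F.P K) k (SU N)} (h𝔄 : ‖frakAOfRecordAtBg128 F N K k Ω U₀ levB Gp Δ2 a hposπ hQ V‖ < a𝔄)
    (h𝔊 : FrakGSliceTok F N K k Ω U₀ Gp Δ2 a hposπ hQ)
    (havg : iterMh k (expOver U₀ ((((F.P K).eta k : ℝ) : ℂ) • evLit F N K k Ω U₀
        ((bgSchemeOfRecord F N K k Ω U₀ dom levB Gp Δ2 a hposπ hposb hQ εC B₀ C₄ a₃ j a𝔄 ε₄).sol V + frakAOfRecordAtBg128 F N K k Ω U₀ levB Gp Δ2 a hposπ hQ V))) =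
      coeField V) :
    COfRecord F N K k Ω U₀ levB
        ((bgSchemeOfRecord F N K k Ω U₀ dom levB Gp Δ2 a hposπ hposb hQ εC B₀ C₄ a₃ j a𝔄 ε₄).sol V + frakAOfRecordAtBg128 F N K k Ω U₀ levB Gp Δ2 a hposπ hQ V) = 0 := by
  have hsum := Q_add_C_eq_B_of_iterMh_eq F N K k Ω U₀ levB _ havg
  rw [readFun_Q_sol_add_frakA F N K k Ω U₀ levB a hposb hQ Gp Δ2 hposπ dom R hJ h𝔄 h𝔊, add_eq_left] at hsum
  exact (NegSup.equiv _ _).injective (by rw [hsum]; rfl)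

/-! ## §5  The positive side: print's field `T47(𝒜 + 𝔄)` averages to `V` on the log-disc (with ✓`readFun_Q_T47_sol_add_frakA`) -/

/-- ★★★ **THE CURED CHART's AVERAGE CLAUSE, on the log-disc**: at the scheme's fixed point, print's transformed field `X := T47(𝒜(V) + 𝔄(V))` satisfies `Q X + C^{𝔰𝔩}(X) = B(V)`
(✓`readFun_Q_T47_sol_add_frakA`, under the EL hypotheses + a Sect. C regime with `ε₄ + a𝔄 ≤ a_C`); if moreover `X` is traceless on the bonds (`C^{𝔰𝔩} = C`,
✓`CslOfRecord_of_trace_eq_zero`) and the two relative units lie in the log-disc, then `Ū^k_h(expOver U₀ (η•evLit X)) = ↑V` — the nonlinear constraint (20) for `exp(iηX)U₀`.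
[cite: Balaban1985Variational, (20) p.281, (44)–(48) p.285, (51) p.286, Prop. 6 (116) p.295] -/
theorem iterMh_T47_eq_of_logDisc (dom : Set (GaugeField (F.P K) k (SU N))) {εC B₀ C₄ a₃ j a𝔄 ε₄ b C₂ c₄ aC : ℝ}
    (R : Regime (frakGOfRecordAtBg128 F N K k Ω U₀ Gp Δ2 a hposπ hQ) (0 : Space115Lit F N K k Ω U₀ →L[ℂ] Space115Lit F N K k Ω U₀)
      (WOfRecordAt F N K k Ω U₀ levB a hposb hQ εC Gp) B₀ 0 C₄ a₃ j a𝔄 ε₄)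
    (hJ : ‖JOfRecordAtBg F N K k Ω U₀‖ ≤ j) {V : GaugeField (F.P K) k (SU N)} (h𝔄 : ‖frakAOfRecordAtBg128 F N K k Ω U₀ levB Gp Δ2 a hposπ hQ V‖ < a𝔄)
    (h𝔊 : FrakGSliceTok F N K k Ω U₀ Gp Δ2 a hposπ hQ)
    (RC : Regime (H1OfRecordAtBgFlat F N K k Ω U₀ levB a hposb hQ) (0 : Space115Lit F N K k Ω U₀ →L[ℂ] Space115Lit F N K k Ω U₀)
      (CslOfRecord F N K k Ω U₀ levB) b 0 C₂ c₄ 0 aC εC)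
    (haC : ε₄ + a𝔄 ≤ aC)
    (htr : ∀ b', (JetSup.equiv _ _ (nabla115 ((F.P K).eta k) (unitsOfRecord F N U₀))
        (T47 (H1OfRecordAtBgFlat F N K k Ω U₀ levB a hposb hQ) (CslOfRecord F N K k Ω U₀ levB) εC
          ((bgSchemeOfRecord F N K k Ω U₀ dom levB Gp Δ2 a hposπ hposb hQ εC B₀ C₄ a₃ j a𝔄 ε₄).sol V + frakAOfRecordAtBg128 F N K k Ω U₀ levB Gp Δ2 a hposπ hQ V)) b').trace = 0)
    (hdiscA : ∀ c, ‖iterMh k (expOver U₀ ((((F.P K).eta k : ℝ) : ℂ) • evLit F N K k Ω U₀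
        (T47 (H1OfRecordAtBgFlat F N K k Ω U₀ levB a hposb hQ) (CslOfRecord F N K k Ω U₀ levB) εC
          ((bgSchemeOfRecord F N K k Ω U₀ dom levB Gp Δ2 a hposπ hposb hQ εC B₀ C₄ a₃ j a𝔄 ε₄).sol V + frakAOfRecordAtBg128 F N K k Ω U₀ levB Gp Δ2 a hposπ hQ V)))) c
        * star (Averaging.iter (avOfRecord F N K) k U₀ c : Matrix (Fin N) (Fin N) ℂ) - 1‖ < 1)
    (hdiscV : ∀ c, ‖(V c : Matrix (Fin N) (Fin N) ℂ) * star (Averaging.iter (avOfRecord F N K) k U₀ c : Matrix (Fin N) (Fin N) ℂ) - 1‖ < 1) :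
    iterMh k (expOver U₀ ((((F.P K).eta k : ℝ) : ℂ) • evLit F N K k Ω U₀
        (T47 (H1OfRecordAtBgFlat F N K k Ω U₀ levB a hposb hQ) (CslOfRecord F N K k Ω U₀ levB) εC
          ((bgSchemeOfRecord F N K k Ω U₀ dom levB Gp Δ2 a hposπ hposb hQ εC B₀ C₄ a₃ j a𝔄 ε₄).sol V + frakAOfRecordAtBg128 F N K k Ω U₀ levB Gp Δ2 a hposπ hQ V)))) =
      coeField V := by
  have h48 := readFun_Q_T47_sol_add_frakA F N K k Ω U₀ levB a hposb hQ Gp Δ2 hposπ dom R hJ h𝔄 h𝔊 RC haC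
  rw [CslOfRecord_of_trace_eq_zero F N K k Ω U₀ levB htr] at h48
  exact iterMh_eq_of_Q_add_C_eq_B F N K k Ω U₀ levB _ h48 hdiscA hdiscV

end Scheme

end Record

end Summit.QuantumFields.YangMills.Theorems.N07ConstraintLogBridge

end
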